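import Mathlib.Geometry.Manifold.IsManifold.Basic
import Mathlib.Analysis.Complex.Basic
import HarnessLib

/-!
# Planar `C^∞` atlases on open subsets (vocabulary of the surface-smoothing programme)

Topic `Literature/Topology/FourManifolds` (the `n = 2` leaf of the smoothing fact
`Literature.Topology.FourManifolds.exists_chartedSpace_isManifold_of_le_three`, spc4.S33, seat 1 /
approach B "smooth-domain seam"). **Definitions with real bodies and their API, all proved; no
named fact.**

The inductive construction of a smooth structure on a topological surface manipulates smooth
structures on *open subsets* `W` of a space `X` (the surface, or the plane `ℂ` in a chart), and
restricts, transports and glues them. Mathlib's `ChartedSpace`/`HasGroupoid` are classes on a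
whole type, which makes "a smooth structure on the open subset `W`, later enlarged" awkward; this
file provides the light-weight bundled version used throughout the programme and its bridge to
Mathlib at the end:

* `IsSmoothCompat e e'` — two planar charts `e e' : OpenPartialHomeomorph X ℂ` are
  `C^∞`-compatible (both transition maps are `C^∞` on their natural domains); symmetric,
  reflexive, stable under restriction (`IsSmoothCompat.symm`, `isSmoothCompat_self`,
  `IsSmoothCompat.restrOpen`), and under composition with a fixed open partial homeomorphism
  (`IsSmoothCompat.trans_left`).
* `PlanarAtlas X W` — a set of planar charts with sources inside `W`, covering `W`, pairwise
  compatible.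
* Operations: `PlanarAtlas.restrict` (to `W ∩ U`, `U` open), `PlanarAtlas.union` (of two atlases
  whose charts are mutually compatible, on `W ∪ W'`), `PlanarAtlas.single` (one chart),
  `PlanarAtlas.comap` (pull back along an `OpenPartialHomeomorph Y X`).
* Bridge (`W = univ`): `PlanarAtlas.toChartedSpace` and `PlanarAtlas.isManifold` — a planar atlas
  on all of `X` is a `ChartedSpace ℂ X` structure which `IsManifold 𝓘(ℝ, ℂ) ∞`.

## References

* A. Hatcher, *The Kirby torus trick for surfaces*, arXiv:1312.3518 (2013), proof of Theorem A
  (smooth structures built on an increasing union of open sets `U_n`). [folklore bookkeeping]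
-/

noncomputable section

open Set Function
open scoped Manifold ContDiff Topology

namespace Literature.Topology.FourManifolds

namespace SurfaceSmoothing

variable {X : Type*} [TopologicalSpace X] {Y : Type*} [TopologicalSpace Y]

/-! ### Compatibility of planar charts -/

/-- Two planar charts are **`C^∞`-compatible**: both transition maps `e' ∘ e⁻¹`, `e ∘ e'⁻¹` are
`C^∞` on their natural (open) domains `(e.symm.trans e').source = e.target ∩ e.symm ⁻¹' e'.source`.
[folklore] -/
def IsSmoothCompat (e e' : OpenPartialHomeomorph X ℂ) : Prop :=
  ContDiffOn ℝ ∞ (e' ∘ e.symm) (e.symm.trans e').source ∧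
    ContDiffOn ℝ ∞ (e ∘ e'.symm) (e'.symm.trans e).source

/-- Compatibility is symmetric. [folklore] -/
theorem IsSmoothCompat.symm {e e' : OpenPartialHomeomorph X ℂ} (h : IsSmoothCompat e e') :
    IsSmoothCompat e' e :=
  ⟨h.2, h.1⟩

/-- Compatibility is symmetric (iff form). [folklore] -/
theorem isSmoothCompat_comm {e e' : OpenPartialHomeomorph X ℂ} : IsSmoothCompat e e' ↔ IsSmoothCompat e' e :=
  ⟨IsSmoothCompat.symm, IsSmoothCompat.symm⟩

/-- The domain of a transition map, spelled out. [folklore] -/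
theorem symm_trans_source (e e' : OpenPartialHomeomorph X ℂ) :
    (e.symm.trans e').source = e.target ∩ e.symm ⁻¹' e'.source := by
  rw [OpenPartialHomeomorph.trans_source, OpenPartialHomeomorph.symm_source]

/-- One half of compatibility, as a standalone predicate on an ordered pair: the transition map
`e' ∘ e⁻¹` is `C^∞` on `e.target ∩ e.symm ⁻¹' e'.source`. [folklore] -/
theorem IsSmoothCompat.contDiffOn {e e' : OpenPartialHomeomorph X ℂ} (h : IsSmoothCompat e e') :
    ContDiffOn ℝ ∞ (e' ∘ e.symm) (e.target ∩ e.symm ⁻¹' e'.source) := by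
  rw [← symm_trans_source]; exact h.1

/-- Compatibility from the two transition maps on the spelled-out domains. [folklore] -/
theorem isSmoothCompat_of_contDiffOn {e e' : OpenPartialHomeomorph X ℂ}
    (h₁ : ContDiffOn ℝ ∞ (e' ∘ e.symm) (e.target ∩ e.symm ⁻¹' e'.source))
    (h₂ : ContDiffOn ℝ ∞ (e ∘ e'.symm) (e'.target ∩ e'.symm ⁻¹' e.source)) : IsSmoothCompat e e' := by
  constructor
  · rw [symm_trans_source]; exact h₁
  · rw [symm_trans_source]; exact h₂

/-- A chart is compatible with itself (the transition map is the identity on `e.target`).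
[folklore] -/
theorem isSmoothCompat_self (e : OpenPartialHomeomorph X ℂ) : IsSmoothCompat e e := by
  have h : ContDiffOn ℝ ∞ (e ∘ e.symm) (e.target ∩ e.symm ⁻¹' e.source) :=
    contDiffOn_id.congr fun z hz => e.right_inv hz.1
  exact isSmoothCompat_of_contDiffOn h h

/-- The target of a restriction to an open set. [folklore] -/
theorem restrOpen_target (e : OpenPartialHomeomorph X ℂ) {U : Set X} (hU : IsOpen U) :
    (e.restrOpen U hU).target = e.target ∩ e.symm ⁻¹' U := rfl

/-- Compatibility passes to restrictions to open sets (the transition maps are the same functions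
on smaller domains). [folklore] -/
theorem IsSmoothCompat.restrOpen {e e' : OpenPartialHomeomorph X ℂ} (h : IsSmoothCompat e e')
    {U U' : Set X} (hU : IsOpen U) (hU' : IsOpen U') :
    IsSmoothCompat (e.restrOpen U hU) (e'.restrOpen U' hU') := by
  refine isSmoothCompat_of_contDiffOn ?_ ?_
  · refine (h.contDiffOn.mono ?_).congr fun z _ => rfl
    rintro z ⟨⟨hz₁, -⟩, hz₂⟩
    simp only [OpenPartialHomeomorph.restrOpen_source, OpenPartialHomeomorph.coe_restrOpen_symm,
      mem_preimage, mem_inter_iff] at hz₂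
    exact ⟨hz₁, hz₂.1⟩
  · refine (h.symm.contDiffOn.mono ?_).congr fun z _ => rfl
    rintro z ⟨⟨hz₁, -⟩, hz₂⟩
    simp only [OpenPartialHomeomorph.restrOpen_source, OpenPartialHomeomorph.coe_restrOpen_symm,
      mem_preimage, mem_inter_iff] at hz₂
    exact ⟨hz₁, hz₂.1⟩

/-- Compatibility is unchanged by composing both charts with the same open partial homeomorphism
on the source side (transport of a structure along `φ : Y → X`): the transition map of
`φ.trans e` and `φ.trans e'` is that of `e` and `e'`, on a smaller domain. [folklore] -/
theorem IsSmoothCompat.trans_left {e e' : OpenPartialHomeomorph X ℂ} (h : IsSmoothCompat e e')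
    (φ : OpenPartialHomeomorph Y X) : IsSmoothCompat (φ.trans e) (φ.trans e') := by
  -- one ordered pair suffices, by symmetry
  suffices key : ∀ {e e' : OpenPartialHomeomorph X ℂ}, IsSmoothCompat e e' →
      ContDiffOn ℝ ∞ ((φ.trans e') ∘ (φ.trans e).symm)
        ((φ.trans e).target ∩ (φ.trans e).symm ⁻¹' (φ.trans e').source) from
    isSmoothCompat_of_contDiffOn (key h) (key h.symm)
  intro e e' h
  refine (h.contDiffOn.mono ?_).congr ?_
  · rintro z ⟨hzt, hzs⟩
    rw [OpenPartialHomeomorph.trans_target, mem_inter_iff, mem_preimage] at hzt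
    rw [mem_preimage, OpenPartialHomeomorph.trans_source, mem_inter_iff, mem_preimage] at hzs
    refine ⟨hzt.1, ?_⟩
    rw [mem_preimage]
    have : (φ.trans e).symm z = φ.symm (e.symm z) := rfl
    rw [this, φ.right_inv hzt.2] at hzs
    exact hzs.2
  · rintro z ⟨hzt, -⟩
    rw [OpenPartialHomeomorph.trans_target, mem_inter_iff, mem_preimage] at hzt
    show e' (φ (φ.symm (e.symm z))) = e' (e.symm z)
    rw [φ.right_inv hzt.2]

/-! ### Planar atlases on open subsets -/

variable (X)

/-- **A planar `C^∞` atlas on a subset `W ⊆ X`**: a set of charts `X ⊇ U ≃ₜ V ⊆ ℂ` with sources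
inside `W`, covering `W`, pairwise `C^∞`-compatible. (When `W = univ` this is the data of a
`ChartedSpace ℂ X` with `HasGroupoid X (contDiffGroupoid ∞ 𝓘(ℝ, ℂ))`, see
`PlanarAtlas.toChartedSpace`.) [folklore] -/
structure PlanarAtlas (W : Set X) where
  /-- The charts. -/
  charts : Set (OpenPartialHomeomorph X ℂ)
  /-- Sources lie inside `W`. -/
  source_subset : ∀ e ∈ charts, e.source ⊆ W
  /-- The sources cover `W`. -/
  covers : ∀ x ∈ W, ∃ e ∈ charts, x ∈ e.source
  /-- The charts are pairwise compatible. -/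
  compat : ∀ e ∈ charts, ∀ e' ∈ charts, IsSmoothCompat e e'

variable {X}

namespace PlanarAtlas

variable {W W' : Set X}

/-- The carrier of a planar atlas is the union of the sources, hence open. [folklore] -/
theorem eq_iUnion_source (𝒜 : PlanarAtlas X W) : W = ⋃ e ∈ 𝒜.charts, e.source := by
  refine Subset.antisymm (fun x hx => ?_) ?_
  · obtain ⟨e, he, hx⟩ := 𝒜.covers x hx
    exact mem_biUnion he hx
  · exact iUnion₂_subset fun e he => 𝒜.source_subset e he

/-- The carrier of a planar atlas is open. [folklore] -/
theorem isOpen (𝒜 : PlanarAtlas X W) : IsOpen W := by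
  rw [𝒜.eq_iUnion_source]
  exact isOpen_biUnion fun e _ => e.open_source

/-- **Restriction** of a planar atlas to `W ∩ U`, `U` open: restrict every chart. [folklore] -/
def restrict (𝒜 : PlanarAtlas X W) (U : Set X) (hU : IsOpen U) : PlanarAtlas X (W ∩ U) where
  charts := (fun e => e.restrOpen U hU) '' 𝒜.charts
  source_subset := by
    rintro _ ⟨e, he, rfl⟩
    rw [OpenPartialHomeomorph.restrOpen_source]
    exact inter_subset_inter_left _ (𝒜.source_subset e he)
  covers := by
    rintro x ⟨hxW, hxU⟩
    obtain ⟨e, he, hx⟩ := 𝒜.covers x hxW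
    exact ⟨e.restrOpen U hU, ⟨e, he, rfl⟩, by rw [OpenPartialHomeomorph.restrOpen_source]; exact ⟨hx, hxU⟩⟩
  compat := by
    rintro _ ⟨e, he, rfl⟩ _ ⟨e', he', rfl⟩
    exact (𝒜.compat e he e' he').restrOpen hU hU

/-- The charts of a restriction. [folklore] -/
theorem restrict_charts (𝒜 : PlanarAtlas X W) (U : Set X) (hU : IsOpen U) :
    (𝒜.restrict U hU).charts = (fun e => e.restrOpen U hU) '' 𝒜.charts := rfl

/-- **Union** of two planar atlases whose charts are mutually compatible. [folklore] -/
def union (𝒜 : PlanarAtlas X W) (ℬ : PlanarAtlas X W')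
    (h : ∀ e ∈ 𝒜.charts, ∀ e' ∈ ℬ.charts, IsSmoothCompat e e') : PlanarAtlas X (W ∪ W') where
  charts := 𝒜.charts ∪ ℬ.charts
  source_subset := by
    rintro e (he | he)
    · exact (𝒜.source_subset e he).trans subset_union_left
    · exact (ℬ.source_subset e he).trans subset_union_right
  covers := by
    rintro x (hx | hx)
    · obtain ⟨e, he, hxe⟩ := 𝒜.covers x hx
      exact ⟨e, Or.inl he, hxe⟩
    · obtain ⟨e, he, hxe⟩ := ℬ.covers x hx
      exact ⟨e, Or.inr he, hxe⟩
  compat := by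
    rintro e (he | he) e' (he' | he')
    · exact 𝒜.compat e he e' he'
    · exact h e he e' he'
    · exact (h e' he' e he).symm
    · exact ℬ.compat e he e' he'

/-- The charts of a union. [folklore] -/
theorem union_charts (𝒜 : PlanarAtlas X W) (ℬ : PlanarAtlas X W')
    (h : ∀ e ∈ 𝒜.charts, ∀ e' ∈ ℬ.charts, IsSmoothCompat e e') :
    (𝒜.union ℬ h).charts = 𝒜.charts ∪ ℬ.charts := rfl

/-- The planar atlas with **a single chart**. [folklore] -/
def single (e : OpenPartialHomeomorph X ℂ) : PlanarAtlas X e.source where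
  charts := {e}
  source_subset := by rintro _ rfl; exact Subset.rfl
  covers := fun x hx => ⟨e, rfl, hx⟩
  compat := by rintro _ rfl _ rfl; exact isSmoothCompat_self _

/-- The chart of `single e`. [folklore] -/
theorem single_charts (e : OpenPartialHomeomorph X ℂ) : (single e).charts = {e} := rfl

/-- The **standard atlas of an open subset of the plane**: the single chart `id` on `U`.
[folklore] -/
def ofOpen (U : Set ℂ) (hU : IsOpen U) : PlanarAtlas ℂ U := by
  have h := single (OpenPartialHomeomorph.ofSet U hU)
  rwa [OpenPartialHomeomorph.ofSet_source] at h

/-- **Pull-back** of a planar atlas along an open partial homeomorphism `φ : Y → X` (e.g. a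
topological chart of a surface): charts `φ.trans e`, carrier `φ.source ∩ φ ⁻¹' W`. [folklore] -/
def comap (𝒜 : PlanarAtlas X W) (φ : OpenPartialHomeomorph Y X) : PlanarAtlas Y (φ.source ∩ φ ⁻¹' W) where
  charts := (fun e => φ.trans e) '' 𝒜.charts
  source_subset := by
    rintro _ ⟨e, he, rfl⟩ y hy
    rw [OpenPartialHomeomorph.trans_source] at hy
    exact ⟨hy.1, 𝒜.source_subset e he hy.2⟩
  covers := by
    rintro y ⟨hy, hyW⟩
    obtain ⟨e, he, hxe⟩ := 𝒜.covers (φ y) hyW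
    exact ⟨φ.trans e, ⟨e, he, rfl⟩, by rw [OpenPartialHomeomorph.trans_source]; exact ⟨hy, hxe⟩⟩
  compat := by
    rintro _ ⟨e, he, rfl⟩ _ ⟨e', he', rfl⟩
    exact (𝒜.compat e he e' he').trans_left φ

/-- The charts of a pull-back. [folklore] -/
theorem comap_charts (𝒜 : PlanarAtlas X W) (φ : OpenPartialHomeomorph Y X) :
    (𝒜.comap φ).charts = (fun e => φ.trans e) '' 𝒜.charts := rfl

/-- Transport of a planar atlas along an equality of carriers. [folklore] -/
def copy (𝒜 : PlanarAtlas X W) (h : W = W') : PlanarAtlas X W' := h ▸ 𝒜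

/-- `copy` does not change the charts. [folklore] -/
@[simp] theorem copy_charts (𝒜 : PlanarAtlas X W) (h : W = W') : (𝒜.copy h).charts = 𝒜.charts := by
  subst h; rfl

/-! ### Bridge to Mathlib: a planar atlas on the whole space is a `C^∞` manifold structure -/

/-- The `ChartedSpace ℂ X` structure of a planar atlas on all of `X` (atlas = the charts; `chartAt`
chosen by the covering property). [folklore] -/
@[reducible] def toChartedSpace (𝒜 : PlanarAtlas X (univ : Set X)) : ChartedSpace ℂ X where
  atlas := 𝒜.charts
  chartAt x := (𝒜.covers x (mem_univ x)).choose
  mem_chart_source x := (𝒜.covers x (mem_univ x)).choose_spec.2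
  chart_mem_atlas x := (𝒜.covers x (mem_univ x)).choose_spec.1

/-- For the trivial model `𝓘(ℝ, ℂ)`, membership of a transition homeomorphism in the `C^∞`
groupoid is smoothness of it and of its inverse on their sources. [folklore] -/
theorem mem_contDiffGroupoid_self_iff (f : OpenPartialHomeomorph ℂ ℂ) :
    f ∈ contDiffGroupoid ∞ 𝓘(ℝ, ℂ) ↔ ContDiffOn ℝ ∞ f f.source ∧ ContDiffOn ℝ ∞ f.symm f.target := by
  rw [contDiffGroupoid, mem_groupoid_of_pregroupoid]
  simp only [contDiffPregroupoid, modelWithCornersSelf_coe, modelWithCornersSelf_coe_symm,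
    CompTriple.comp_eq, preimage_id_eq, id_eq, range_id, inter_univ]

/-- **A planar atlas on all of `X` is a `C^∞` structure**: with the charted-space structure
`𝒜.toChartedSpace`, `X` has the `C^∞` groupoid for the model `𝓘(ℝ, ℂ)`. [folklore] -/
theorem hasGroupoid (𝒜 : PlanarAtlas X (univ : Set X)) :
    @HasGroupoid ℂ _ X _ 𝒜.toChartedSpace (contDiffGroupoid ∞ 𝓘(ℝ, ℂ)) := by
  letI := 𝒜.toChartedSpace
  refine ⟨fun {e e'} he he' => ?_⟩
  rw [mem_contDiffGroupoid_self_iff]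
  have h := 𝒜.compat e he e' he'
  constructor
  · exact h.1.congr fun z _ => rfl
  · have h2 := h.2
    have hs : (e.symm.trans e').target = (e'.symm.trans e).source := by
      rw [OpenPartialHomeomorph.trans_target, symm_trans_source, OpenPartialHomeomorph.symm_target]
    rw [hs]
    exact h2.congr fun z _ => rfl

/-- **A planar atlas on all of `X` makes `X` a `C^∞` manifold modelled on `ℂ`** (with the
charted-space structure `𝒜.toChartedSpace`). [folklore] -/
theorem isManifold (𝒜 : PlanarAtlas X (univ : Set X)) :
    @IsManifold ℝ _ ℂ _ _ ℂ _ 𝓘(ℝ, ℂ) ∞ X _ 𝒜.toChartedSpace :=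
  @IsManifold.mk' ℝ _ ℂ _ _ ℂ _ 𝓘(ℝ, ℂ) ∞ X _ 𝒜.toChartedSpace 𝒜.hasGroupoid

end PlanarAtlas

end SurfaceSmoothing

end Literature.Topology.FourManifolds
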